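import Literature.AnabelianGeometry.SemiGraphs.PSCVertexQuotientNontrivialProofs
import Literature.AnabelianGeometry.SemiGraphs.PSCCuspidalCriterionProofs
import Literature.AnabelianGeometry.SemiGraphs.PSCSmoothProperShape
import Literature.AnabelianGeometry.AbsoluteAnabelian.LocalReciprocityCofinal
import Mathlib.Topology.Algebra.ClopenNhdofOne
import HarnessLib

/-!
# [CombGC] Theorem 1.6 (iii) for general `Σ`: the common prime of `Σ_G`, `Σ_H` is automatic for `β : Π^unr_G ≅ Π^unr_H`

Mochizuki, *A combinatorial version of the Grothendieck conjecture*, Tohoku Math. J. **59** (2007)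
[CombGC], Theorem 1.6 (iii), author's ms p. 13: for `G`, `H` sturdy of pro-`Σ` PSC-type and
`β : Π^unr_G ⥲ Π^unr_H`, "`β` is verticially filtration-preserving if and only if it is
group-theoretically verticial"; proof, p. 13 l.−5…−4: "we may assume `Σ = {l}`".

The cell's kernel of Theorem 1.6 (iii) (sub-DAG `plan/L3/SUBDAG-CombGC-Thm16.md`, rows T16-L13…L16)
is typed at `Σ_G = Σ_H = {l}` (`unrVerticialIff_holds_of_inputs′`); the general-`Σ` closer runs the
printed pro-`l` reduction on `Π^unr`-levels for a prime `l ∈ Σ_G ∩ Σ_H` (row T16-L04c (iii),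
abc-iut-w4-d052) and, over the interface `PSCDatum` ([CombGC] Def. 1.1 (ii), abc-iut-L3-t4) where each
datum carries its own `Σ`, DISPLAYS that common prime.  Companion of `PSCCommonPrimeProofs.lean` (the
same service for Theorem 1.6 (i), where an isomorphism `α : Π_G ≅ Π_H` of the full groups is in hand),
this proof-only file shows the common prime is AUTOMATIC also when only `β : Π^unr_G ≅ Π^unr_H` is given:

* `exists_mem_sigma_inter_of_unrContinuousMulEquiv` — `Π^unr_G = Π_G / Ker` is again pro-`Σ_G`
  (an open normal subgroup of the profinite `Π_G / Ker` pulls back to `Π_G` with the same index), so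
  for `Ker ≠ Π_G` a proper open normal subgroup of `Π^unr_G` has index `> 1` with prime factors in
  `Σ_G` (`PSCDatum.proSigma`) and — through `β` and pull-back to `Π_H` — in `Σ_H`;
* `unrKer_ne_top_of_sturdy` — for sturdy `G` granted the rank of `M^unr_G[v]` ([CombGC] Rmk. 1.1.5,
  `UnrVertAbOfRank`: `M^unr_G[v] / E` is the pro-`Σ` completion of `ℤ^{2·g(v)}`, `2·g(v) ≥ 4`) at a
  vertex `v`: `Ker ≠ Π_G`;
* `unrKer_ne_top_of_isEmpty` — the vertexless datum (admitted by the interface, not by print; then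
  there are no edges and `Ker = 1`) granted Rmk. 1.1.3 (`AbelianizedGrphRank`: `Π^grph_G` free pro-`Σ`
  of rank `n − i + 1 = 1`): `Π_G ≠ 1`, so `Ker ≠ Π_G`; `unrKer_ne_top_of_inputs` — both cases;
* `exists_mem_sigma_inter_unr_holds` — over an origin `Ω` with profinite data: `RankStatementsHold Ω`,
  `UnrVertAbOfRankHolds Ω`, `G` sturdy ⟹ a common prime of `Σ_G`, `Σ_H` for every `β`;
* **`unrVerticialIff_holds_of_commonPrimeVersion`** — the Ω-ADAPTER: any proof of the typed
  Theorem 1.6 (iii) for `Ω`-data displaying `∃ l ∈ Σ_G ∩ Σ_H` yields `UnrVerticialIffHolds Ω`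
  ([CombGC] Thm. 1.6 (iii) AS TYPED, abc-iut-L3-t4's `PSCGraphicity.lean`) with NO displayed
  hypothesis (the sturdiness the common prime needs is the antecedent of the typed iff).

Proof-only (0 defs); plain profinite group theory over the interface; a FACT row is an assumption
label — nothing here asserts the printed claims for curves, and nothing here takes a side on
[IUTchIII] Cor. 3.12. [cite: MochizukiCombGC2007, Thm 1.6(iii) p.13] [cite: MochizukiCombGC2007, Def 1.1(ii) p.6]
[cite: MochizukiCombGC2007, Rmk 1.1.5 p.8]
-/

noncomputable section

namespace Literature.AnabelianGeometry.SemiGraphs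

namespace PSCDatum

open scoped Pointwise
open SemiGraphOfAnabelioids (IsProSigmaCompletion)

universe u

variable {P : Type u} [Group P] [TopologicalSpace P] [IsTopologicalGroup P]
variable {P' : Type u} [Group P'] [TopologicalSpace P'] [IsTopologicalGroup P']

/-! ### The common prime from `β : Π^unr_G ≅ Π^unr_H` -/

section Sigma

omit [IsTopologicalGroup P] in
/-- `Σ_G` contains every prime dividing the index of an open normal subgroup of finite index of `Π_G`
([CombGC] Def. 1.1 (ii), "the maximal pro-`Σ` quotient", interface field `PSCDatum.proSigma`; variant
of `prime_mem_sigma_of_dvd_index` of `PSCCommonPrimeProofs.lean`, kept local to spare the import).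
[cite: MochizukiCombGC2007, Def 1.1(ii) p.6] -/
private theorem prime_mem_sigma_of_dvd_index_aux (G : PSCDatum P) {U : Subgroup P} [hUn : U.Normal]
    [U.FiniteIndex] (hUo : IsOpen (U : Set P)) {p : ℕ} (hp : p.Prime) (hdvd : p ∣ U.index) :
    p ∈ G.Sigma :=
  G.proSigma.prime_mem { toSubgroup := U, isOpen' := hUo, isNormal' := hUn }
    (show Finite (P ⧸ U) from inferInstance) p hp hdvd

/-- **The common prime is automatic for `β : Π^unr_G ≅ Π^unr_H`.**  For `Π_G` profinite with
`Ker(Π_G ↠ Π^unr_G) ≠ Π_G` and ANY isomorphism of topological groups `β : Π^unr_G ≅ Π^unr_H`, some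
prime lies in `Σ_G ∩ Σ_H`: `Π^unr_G` is profinite and nontrivial, a proper open normal subgroup
`Ū ⊆ Π^unr_G` pulls back to an open normal `U ⊆ Π_G` of the same index `> 1`, whose prime factors lie
in `Σ_G` (`Π_G` pro-`Σ_G`), and `β(Ū)` pulls back to `Π_H` with the same index, so they lie in `Σ_H`.
(In print `Σ_G = Σ_H = Σ` by convention, [CombGC] Thm. 1.6, p. 13.)
[cite: MochizukiCombGC2007, Thm 1.6(iii) p.13] [cite: MochizukiCombGC2007, Def 1.1(ii) p.6] -/
theorem exists_mem_sigma_inter_of_unrContinuousMulEquiv [CompactSpace P] [TotallyDisconnectedSpace P]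
    (G : PSCDatum P) (H : PSCDatum P') (hK : G.unrKer ≠ ⊤)
    (β : (P ⧸ G.unrKer) ≃ₜ* (P' ⧸ H.unrKer)) : ∃ l : ℕ, l ∈ G.Sigma ∧ l ∈ H.Sigma := by
  haveI : Nontrivial (P ⧸ G.unrKer) := QuotientGroup.nontrivial_iff.mpr hK
  haveI : TotallyDisconnectedSpace (P ⧸ G.unrKer) :=
    AbsoluteAnabelian.QuotientGroup.totallyDisconnectedSpace_of_isClosed _
      (Subgroup.isClosed_topologicalClosure _)
  -- a proper open normal subgroup of `Π^unr_G`
  obtain ⟨x, hx⟩ := exists_ne (1 : P ⧸ G.unrKer)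
  obtain ⟨Ub, hUb⟩ := ProfiniteGrp.exist_openNormalSubgroup_sub_open_nhds_of_one
    (isOpen_compl_singleton (x := x)) (Set.mem_compl_singleton_iff.mpr hx.symm)
  have hUbne : (Ub : Subgroup (P ⧸ G.unrKer)) ≠ ⊤ := by
    intro h
    have hxU : x ∈ ((Ub : Subgroup (P ⧸ G.unrKer)) : Set (P ⧸ G.unrKer)) := by
      rw [h]; exact Subgroup.mem_top x
    exact (Set.mem_compl_singleton_iff.mp (hUb hxU)) rfl
  -- pull back to `Π_G`
  set π := QuotientGroup.mk' G.unrKer with hπ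
  set U : Subgroup P := (Ub : Subgroup (P ⧸ G.unrKer)).comap π with hU
  haveI : U.Normal := Ub.isNormal'.comap π
  have hUo : IsOpen (U : Set P) := by
    rw [hU, Subgroup.coe_comap]
    exact Ub.isOpen.preimage (by exact QuotientGroup.continuous_mk)
  haveI : U.FiniteIndex := finiteIndex_of_isOpen U hUo
  have hidxU : U.index = (Ub : Subgroup (P ⧸ G.unrKer)).index :=
    Subgroup.index_comap_of_surjective _ (QuotientGroup.mk'_surjective _)
  haveI : (Ub : Subgroup (P ⧸ G.unrKer)).FiniteIndex :=
    ⟨by rw [← hidxU]; exact Subgroup.FiniteIndex.index_ne_zero⟩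
  have h1 : 1 < U.index := by
    rw [hidxU]; exact Subgroup.one_lt_index_of_ne_top hUbne
  obtain ⟨p, hp, hdvd⟩ := Nat.exists_prime_and_dvd h1.ne'
  refine ⟨p, G.prime_mem_sigma_of_dvd_index_aux hUo hp hdvd, ?_⟩
  -- transport along `β` and pull back to `Π_H`
  set f := β.toMulEquiv.toMonoidHom with hf
  set Ub' : Subgroup (P' ⧸ H.unrKer) := (Ub : Subgroup (P ⧸ G.unrKer)).map f with hUb'
  haveI : Ub'.Normal := Ub.isNormal'.map f β.surjective
  have hUb'o : IsOpen (Ub' : Set (P' ⧸ H.unrKer)) := by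
    rw [hUb', Subgroup.coe_map]
    exact β.toHomeomorph.isOpenMap _ Ub.isOpen
  set π' := QuotientGroup.mk' H.unrKer with hπ'
  set U' : Subgroup P' := Ub'.comap π' with hU'
  haveI : U'.Normal := Subgroup.Normal.comap inferInstance π'
  have hU'o : IsOpen (U' : Set P') := by
    rw [hU', Subgroup.coe_comap]
    exact hUb'o.preimage (by exact QuotientGroup.continuous_mk)
  have hidx' : U'.index = U.index := by
    rw [hU', Subgroup.index_comap_of_surjective _ (QuotientGroup.mk'_surjective _), hUb',
      Subgroup.index_map_of_bijective (f := f) ⟨β.injective, β.surjective⟩ _, hidxU]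
  haveI : U'.FiniteIndex := ⟨by rw [hidx']; exact Subgroup.FiniteIndex.index_ne_zero⟩
  exact H.prime_mem_sigma_of_dvd_index_aux hU'o hp (by rw [hidx']; exact hdvd)

end Sigma

/-! ### `Ker(Π_G ↠ Π^unr_G) ≠ Π_G` from the rank statements -/

section Nontrivial

/-- **Sturdy data have `Π^unr_G ≠ 1`** (granted [CombGC] Rmk. 1.1.5, `UnrVertAbOfRank`, at a vertex
`v`): `M^unr_G[v] / E` is the pro-`Σ` completion of `ℤ^{2·g(v)}` with `2·g(v) ≥ 4`, a nontrivial group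
(it has a proper open subgroup, `exists_open_ne_top_pow_mem`), whereas `Ker = Π_G` would force
`E = M^unr_G[v] = Π_G`. [cite: MochizukiCombGC2007, Rmk 1.1.5 p.8] -/
theorem unrKer_ne_top_of_sturdy (G : PSCDatum P) (hGs : G.IsSturdy) (hrank : G.UnrVertAbOfRank)
    (v : G.graph.V) : G.unrKer ≠ ⊤ := by
  intro hK
  obtain ⟨l, hlS⟩ := G.sigma_nonempty
  have hl : l.Prime := G.sigma_prime l hlS
  haveI : G.unrAbKer.Normal := normal_of_commutator_le G.commutator_le_unrAbKer
  haveI : (G.unrAbKer.subgroupOf (G.unrVertAbOf v)).Normal := inferInstance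
  obtain ⟨ι, hι⟩ := hrank v
  have hr : 0 < 2 * G.genus v := by have := hGs v; omega
  obtain ⟨U, -, hUne, -⟩ := exists_open_ne_top_pow_mem ⟨0, hr⟩ hι hl hlS
  have hE : G.unrAbKer = ⊤ :=
    top_le_iff.mp (hK.ge.trans (le_sup_right.trans (Subgroup.le_topologicalClosure _)))
  haveI : Subsingleton (G.unrVertAbOf v ⧸ G.unrAbKer.subgroupOf (G.unrVertAbOf v)) := by
    rw [QuotientGroup.subsingleton_iff, hE, Subgroup.top_subgroupOf]
  exact hUne (Subsingleton.elim _ _)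

/-- **The vertexless datum has `Π^unr_G ≠ 1`** (granted [CombGC] Rmk. 1.1.3, `AbelianizedGrphRank`):
with no vertices there are no edges, `Ker = 1`, and `Π_G / \overline{[Π_G, Π_G]} = Π^grph,ab_G` is the
pro-`Σ` completion of `ℤ^{n − i + 1} = ℤ`, so `Π_G ≠ 1`.  (The interface admits the vertexless datum;
print does not.) [cite: MochizukiCombGC2007, Rmk 1.1.3 p.8] -/
theorem unrKer_ne_top_of_isEmpty [T1Space P] (G : PSCDatum P) [IsEmpty G.graph.V]
    (hgr : G.AbelianizedGrphRank) : G.unrKer ≠ ⊤ := by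
  intro hK
  haveI : IsEmpty G.graph.N := Function.isEmpty G.graph.nodeEnds
  haveI : IsEmpty G.graph.C := Function.isEmpty G.graph.cuspEnd
  -- `Π_G` is trivial (no edges: `Ker = closure {1}`, abc-iut-L3-t4's `unrKer_eq_closure_bot_of_isEmpty`)
  have hbot : (⊥ : Subgroup P).topologicalClosure = ⊥ :=
    le_bot_iff.mp (Subgroup.topologicalClosure_minimal ⊥ le_rfl (by
      rw [Subgroup.coe_bot]; exact isClosed_singleton))
  have htop : (⊤ : Subgroup P) = ⊥ := by rw [← hK, G.unrKer_eq_closure_bot_of_isEmpty, hbot]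
  haveI : Subsingleton P := ⟨fun a b => by
    have ha : a ∈ (⊥ : Subgroup P) := htop ▸ Subgroup.mem_top a
    have hb : b ∈ (⊥ : Subgroup P) := htop ▸ Subgroup.mem_top b
    rw [Subgroup.mem_bot] at ha hb
    rw [ha, hb]⟩
  -- but `Π_G / vertFil Π_G` is the pro-`Σ` completion of `ℤ^1`
  obtain ⟨l, hlS⟩ := G.sigma_nonempty
  have hl : l.Prime := G.sigma_prime l hlS
  haveI : ((G.vertFil ⊤).subgroupOf ⊤).Normal := by
    rw [Subsingleton.elim ((G.vertFil ⊤).subgroupOf ⊤) ⊤]; infer_instance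
  obtain ⟨ι, hι⟩ := hgr ⊤ (by rw [Subgroup.coe_top]; exact isOpen_univ)
  have hV : G.vertCount ⊤ = 0 := by
    unfold vertCount; exact Fintype.sum_empty _
  have hr : 0 < G.nodeCount ⊤ + 1 - G.vertCount ⊤ := by rw [hV]; omega
  obtain ⟨U, -, hUne, -⟩ := exists_open_ne_top_pow_mem ⟨0, hr⟩ hι hl hlS
  haveI : Subsingleton ((⊤ : Subgroup P) ⧸ (G.vertFil ⊤).subgroupOf ⊤) :=
    QuotientGroup.subsingleton_iff.mpr (Subsingleton.elim _ _)
  exact hUne (Subsingleton.elim _ _)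

/-- **`Ker(Π_G ↠ Π^unr_G) ≠ Π_G` from the rank statements**: sturdy `G` (vertex case: Rmk. 1.1.5,
`UnrVertAbOfRank`; vertexless case: Rmk. 1.1.3, `AbelianizedGrphRank`).
[cite: MochizukiCombGC2007, Rmk 1.1.5 p.8] [cite: MochizukiCombGC2007, Rmk 1.1.3 p.8] -/
theorem unrKer_ne_top_of_inputs [T1Space P] (G : PSCDatum P) (hGs : G.IsSturdy)
    (hrank : G.UnrVertAbOfRank) (hgr : G.AbelianizedGrphRank) : G.unrKer ≠ ⊤ := by
  rcases isEmpty_or_nonempty G.graph.V with hV | ⟨⟨v⟩⟩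
  · exact G.unrKer_ne_top_of_isEmpty hgr
  · exact G.unrKer_ne_top_of_sturdy hGs hrank v

end Nontrivial

/-! ### Over the origin: the common prime, and the adapter for Theorem 1.6 (iii) -/

section Origin

variable (Ω : PSCOrigin.{u})

/-- **The common prime of `Σ_G`, `Σ_H` for `β : Π^unr_G ≅ Π^unr_H`, over the origin `Ω`**: for `G`, `H`
(`G` of `Ω`-type on a profinite group, displayed `hprof`; `H` any datum), granted Rmk. 1.1.3 / 1.1.5
(`RankStatementsHold`, `UnrVertAbOfRankHolds`) and `G` sturdy, some prime lies in `Σ_G ∩ Σ_H`.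
[cite: MochizukiCombGC2007, Thm 1.6(iii) p.13] -/
theorem exists_mem_sigma_inter_unr_holds
    (hprof : ∀ ⦃Q : Type u⦄ [Group Q] [TopologicalSpace Q] [IsTopologicalGroup Q] (K : PSCDatum Q),
      Ω.IsOfPSCType K → CompactSpace Q ∧ TotallyDisconnectedSpace Q)
    (hrank : RankStatementsHold Ω) (hrankv : UnrVertAbOfRankHolds Ω)
    ⦃Q : Type u⦄ [Group Q] [TopologicalSpace Q] [IsTopologicalGroup Q]
    ⦃Q' : Type u⦄ [Group Q'] [TopologicalSpace Q'] [IsTopologicalGroup Q']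
    {G : PSCDatum Q} {H : PSCDatum Q'} (hGΩ : Ω.IsOfPSCType G)
    (hGs : G.IsSturdy) (β : (Q ⧸ G.unrKer) ≃ₜ* (Q' ⧸ H.unrKer)) :
    ∃ l : ℕ, l ∈ G.Sigma ∧ l ∈ H.Sigma := by
  obtain ⟨hcQ, htQ⟩ := hprof G hGΩ
  exact G.exists_mem_sigma_inter_of_unrContinuousMulEquiv H
    (G.unrKer_ne_top_of_inputs hGs (hrankv G hGΩ) (hrank G hGΩ).1) β

/-- **Ω-ADAPTER for [CombGC] Theorem 1.6 (iii) with general `Σ`.**  Any proof of the typed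
Theorem 1.6 (iii) (`UnrVerticiallyFiltrationPreservingIffVerticial`) for all `Ω`-data that DISPLAYS a
common prime `∃ l ∈ Σ_G ∩ Σ_H` (the shape of the cell's pro-`l` shadow route on `Π^unr`-levels, row
T16-L04c (iii) of `plan/L3/SUBDAG-CombGC-Thm16.md`) yields the typed statement `UnrVerticialIffHolds Ω`
of abc-iut-L3-t4's `PSCGraphicity.lean` with NO displayed hypothesis, granted profiniteness and
Rmk. 1.1.3 / 1.1.5 (`RankStatementsHold`, `UnrVertAbOfRankHolds`) — the sturdiness the common prime
needs being the antecedent of the typed iff. [cite: MochizukiCombGC2007, Thm 1.6(iii) p.13] -/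
theorem unrVerticialIff_holds_of_commonPrimeVersion
    (hprof : ∀ ⦃Q : Type u⦄ [Group Q] [TopologicalSpace Q] [IsTopologicalGroup Q] (K : PSCDatum Q),
      Ω.IsOfPSCType K → CompactSpace Q ∧ TotallyDisconnectedSpace Q)
    (hrank : RankStatementsHold Ω) (hrankv : UnrVertAbOfRankHolds Ω)
    (h : ∀ ⦃Q : Type u⦄ [Group Q] [TopologicalSpace Q] [IsTopologicalGroup Q]
      ⦃Q' : Type u⦄ [Group Q'] [TopologicalSpace Q'] [IsTopologicalGroup Q']
      (G : PSCDatum Q) (H : PSCDatum Q') (β : (Q ⧸ G.unrKer) ≃ₜ* (Q' ⧸ H.unrKer)),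
      Ω.IsOfPSCType G → Ω.IsOfPSCType H → (∃ l : ℕ, l ∈ G.Sigma ∧ l ∈ H.Sigma) →
        G.UnrVerticiallyFiltrationPreservingIffVerticial H β) :
    Literature.AnabelianGeometry.SemiGraphs.PSCDatum.UnrVerticialIffHolds Ω := by
  intro Q _ _ _ Q' _ _ _ G H β hGΩ hHΩ hGs hHs
  exact h G H β hGΩ hHΩ (exists_mem_sigma_inter_unr_holds Ω hprof hrank hrankv hGΩ hGs β) hGs hHs

end Origin

end PSCDatum

end Literature.AnabelianGeometry.SemiGraphs

end
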